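import Summits.Ventures.WeilGRH.TwistedMomentCertOdd
import Summits.Ventures.WeilGRH.TwistedMomentCertSound
import HarnessLib

/-!
# Twisted moment certificates, odd characters (IV): soundness of `TwistCertOdd`

Cell `rh-explicit`, WEIL TRACK — GRH ARM (namespace `Summit.Ventures.WeilGRH`).  The soundness theorem of the odd
certificate (`TwistedMomentCertOdd.lean`): as `TwistCert.form_nonneg_of_check` (`TwistedMomentCertSound.lean`:
Step B over the cell minorant of the EVEN part `W` of the weight, Step C, the signed-`γ` price, rounding, `κ`,
Bessel, `WeilCert.core_nonnegK`) with ONE extra input, the parity bonus in the moments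
(`re_integral_weilConv_weilReflect_sech_ge`, `TwistedBonusMoments.lean`): the bonus matrix rides in the block
machinery through the doubly shifted table (`pmQexactOdd_cast`) and its approximation price `2a₀ε` comes off `κ`.

**`TwistCertOdd.form_nonneg_of_check`**: `checkAlgOdd ∧ CellsOKW ∧ (wL − γ ≤ W) ∧ ellLo ≤ ℓ ⟹
0 ≤ ℓ‖g‖₂² + (1/2π)∫|ĝ|² W + Re ∫ (g ⋆ g̃)(w) dw/(2cosh(w/2))` on `C(b)`.  Everything here is PROVED; no named facts.
-/

noncomputable section

open Complex Finset MeasureTheory Set Filter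
open scoped Real Topology ComplexConjugate BigOperators

namespace Summit.Ventures.WeilGRH

open Literature.NumberTheory.LFunctions Literature.Analysis.ValidatedNumerics.Numerics
open Literature.Analysis.SpecialFunctions

namespace TwistCertOdd

variable {c : TwistCertOdd} {w W : ℝ → ℝ} {g : ℝ → ℂ}

/-! ### The main theorem -/

set_option maxHeartbeats 1600000 in
/-- **Soundness of the odd (bonus) moment-method certificate.** If `c.checkAlgOdd = true`, the cells are a
valid chain for some even weight `w ≤ W` (the EVEN part of the true weight), `|ĝ|² W` is integrable and
`ellLo ≤ ℓ`, then for every test function `g` with `tsupport g ⊆ [-b, b]`: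
`0 ≤ ℓ ‖g‖₂² + (1/2π) ∫ |ĝ(1/2+iτ)|² W(τ) dτ + Re ∫ (g ⋆ g̃)(w) dw/(2cosh(w/2))` — the last term being the parity
bonus `(1/2π)∫|ĝ|² π sech(πτ)` in position form. [folklore] -/
theorem form_nonneg_of_check (h : c.checkAlgOdd = true) (hcells : CellsOKW c.cert.base.wL c.cert.base.T c.cert.cells w)
    (hlevel : ∀ t : ℝ, (c.cert.base.wL : ℝ) - cellsGamma₂ c.cert.base.wL c.cert.cells t ≤ W t)
    {ℓ : ℝ} (hℓ : ((c.cert.ellLo : ℚ) : ℝ) ≤ ℓ) (hg : IsWeilTest g)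
    (hWi : Integrable fun t : ℝ ↦ ‖weilMellin g (1 / 2 + t * I)‖ ^ 2 * W t)
    (hsupp : tsupport g ⊆ Icc (-(c.cert.b : ℝ)) c.cert.b) :
    0 ≤ ℓ * weilNorm2Sq g + 1 / (2 * π) * (∫ t : ℝ, ‖weilMellin g (1 / 2 + t * I)‖ ^ 2 * W t) +
      (∫ w : ℝ, weilConv g (weilReflect g) w * (((1 / (2 * Real.cosh (w / 2)) : ℝ) : ℂ))).re := by
  obtain ⟨hsce, hsc, hnuchk, hb0, hb1⟩ := checkAlgOdd_spec h
  obtain ⟨⟨hbpos, hba, ha1q, hT, haT, hρT, hN, hκ⟩, hpclen, hpceven, hnn⟩ := scalarsOdd_spec hsc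
  set a : ℝ := (c.cert.base.a0 : ℝ) with ha_def
  have hba' : ((c.cert.b : ℚ) : ℝ) ≤ a := by rw [ha_def]; exact_mod_cast hba
  have hb0' : (0 : ℝ) < c.cert.b := by exact_mod_cast hbpos
  have ha : 0 < a := by linarith
  have hsupp' : tsupport g ⊆ Icc (-a) a := hsupp.trans (Icc_subset_Icc (by linarith) hba')
  set n := c.cert.base.N + 1 with hn
  set nu := c.cert.nuTab with hnu
  set M : ℕ → ℂ := weilMoment a g with hM
  set L := weilNorm1 g with hL
  set N2 := weilNorm2Sq g with hN2
  set z : ℕ → ℕ → ℝ := fun k l ↦ (conj (M k) * M l).re with hz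
  have hL0 : 0 ≤ L := weilNorm1_nonneg g
  have hN20 : 0 ≤ N2 := weilNorm2Sq_nonneg g
  have hL1 : L ^ 2 ≤ 2 * a * N2 := weilNorm1_sq_le hg ha hsupp'
  set A : ℝ := ∫ t : ℝ, ‖weilMellin g (1 / 2 + t * I)‖ ^ 2 * W t with hA
  set Γ : ℝ := ∫ t : ℝ, ‖weilMellin g (1 / 2 + t * I)‖ ^ 2 * cellsGamma₂ c.cert.base.wL c.cert.cells t with hΓ
  -- Step B
  have hB : (c.cert.base.wL : ℝ) * (2 * π * N2) - Γ ≤ A := TwistCert.arch_lower_bound hlevel hg hWi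
  -- Step C
  have hC : Γ ≤ ∑ k ∈ range n, ∑ l ∈ range n, TwistCert.gHat c.cert k l * z k l + 5 * L ^ 2 * (c.cert.nuPrimeAbs : ℝ) := by
    have := TwistCert.freq_integral_bound hcells hsce hg (by rwa [← ha_def])
    rw [← ha_def] at this
    exact this
  -- constants
  set q : ℝ := ((invTwoPiHi20 : ℚ) : ℝ) with hq
  set qLo : ℝ := ((invTwoPiLo20 : ℚ) : ℝ) with hqLo
  have hq1 : 1 / (2 * π) ≤ q := invTwoPiHi20_ge
  have hq0 : 0 ≤ q := invTwoPiHi20_nonneg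
  have hqLo1 : qLo ≤ 1 / (2 * π) := invTwoPiLo20_le
  have hν0 : 0 ≤ ((c.cert.nuPrimeAbs : ℚ) : ℝ) := by
    unfold TwistCert.nuPrimeAbs
    have h1 : (0 : ℝ) ≤ (cellsAbsMomentQ c.cert.base.wL c.cert.cells (c.cert.base.N + 1) : ℝ) := by
      rw [← (integral_stepAux_mul_powW (wL := c.cert.base.wL) hcells.valid (c.cert.base.N + 1)).2]
      refine integral_nonneg fun s' ↦ mul_nonneg ((stepAux_propsW (wL := c.cert.base.wL)
        hcells.valid).1.choose_spec s').1 ?_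
      have hev : Even (c.cert.base.N + 1) := ⟨c.cert.base.nb, by omega⟩
      rw [← hev.pow_abs]; positivity
    push_cast
    have ha0 : (0 : ℝ) ≤ (c.cert.base.a0 : ℝ) := by rw [← ha_def]; exact ha.le
    positivity
  have hpi : 0 < 1 / (2 * π) := by positivity
  -- the signed `Γ`: `−(1/2π)Γ ≥ −qX − (q − qLo)·C₀·7·N2`
  set C₀ : ℝ := ((cellsBndMaxQ c.cert.base.wL c.cert.cells : ℚ) : ℝ) with hC₀
  have hC₀0 : 0 ≤ C₀ := by rw [hC₀]; exact_mod_cast cellsBndMaxQ_nonneg c.cert.base.wL c.cert.cells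
  have hγabs : ∀ t, |cellsGamma₂ c.cert.base.wL c.cert.cells t| ≤ C₀ := fun t ↦ by
    rw [hC₀]; exact abs_cellsGamma₂_le_bndMaxW hcells t
  set ind : ℝ → ℝ := Set.indicator (Icc (-(c.cert.base.T : ℝ)) c.cert.base.T) (fun _ ↦ (1 : ℝ)) with hind
  have hind01 : ∀ t, 0 ≤ ind t ∧ ind t ≤ 1 := fun t ↦ by
    rw [hind]; by_cases ht : t ∈ Icc (-(c.cert.base.T : ℝ)) c.cert.base.T
    · rw [Set.indicator_of_mem ht]; norm_num
    · rw [Set.indicator_of_notMem ht]; norm_num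
  have hindm : Measurable ind := by rw [hind]; exact measurable_const.indicator measurableSet_Icc
  set PiT : ℝ := ∫ t : ℝ, ‖weilMellin g (1 / 2 + t * I)‖ ^ 2 * ind t with hPiT
  have hiPiT : Integrable fun t : ℝ ↦ ‖weilMellin g (1 / 2 + t * I)‖ ^ 2 * ind t :=
    integrable_norm_sq_weilMellin_mul hg hindm (A := 1) (B := 0) zero_le_one le_rfl fun t ↦ by
      rw [zero_mul, add_zero, abs_of_nonneg (hind01 t).1]; exact (hind01 t).2
  obtain ⟨BΓ, hBΓ0, hBΓ⟩ := exists_abs_cellsGamma₂_le c.cert.base.wL c.cert.cells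
  have hiΓ : Integrable fun t : ℝ ↦ ‖weilMellin g (1 / 2 + t * I)‖ ^ 2 * cellsGamma₂ c.cert.base.wL c.cert.cells t :=
    integrable_norm_sq_weilMellin_mul hg (measurable_cellsGamma₂ _ _) hBΓ0 le_rfl (B := 0)
      (fun t ↦ by simpa using hBΓ t)
  have hPiT0 : 0 ≤ PiT := integral_nonneg fun t ↦ mul_nonneg (sq_nonneg _) (hind01 t).1
  have hPiTle : PiT ≤ 7 * N2 := by
    have h1 : PiT ≤ ∫ t : ℝ, ‖weilMellin g (1 / 2 + t * I)‖ ^ 2 :=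
      integral_mono hiPiT (integrable_norm_sq_weilMellin_half_line hg) fun t ↦ by
        simpa using mul_le_mul_of_nonneg_left (hind01 t).2 (sq_nonneg ‖weilMellin g (1 / 2 + t * I)‖)
    rw [integral_norm_sq_weilMellin_half_line hg] at h1
    have h7 : 2 * π ≤ 7 := by linarith [Real.pi_lt_d2]
    nlinarith
  have hΓplus : 0 ≤ Γ + C₀ * PiT := by
    rw [hΓ, hPiT, ← integral_const_mul, ← integral_add hiΓ (hiPiT.const_mul _)]
    refine integral_nonneg fun t ↦ ?_
    rw [show ‖weilMellin g (1 / 2 + t * I)‖ ^ 2 * cellsGamma₂ c.cert.base.wL c.cert.cells t +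
        C₀ * (‖weilMellin g (1 / 2 + t * I)‖ ^ 2 * ind t) =
        ‖weilMellin g (1 / 2 + t * I)‖ ^ 2 * (cellsGamma₂ c.cert.base.wL c.cert.cells t + C₀ * ind t) by ring]
    refine mul_nonneg (sq_nonneg _) ?_
    by_cases ht : t ∈ Icc (-(c.cert.base.T : ℝ)) c.cert.base.T
    · have : ind t = 1 := by rw [hind, Set.indicator_of_mem ht]
      rw [this, mul_one]
      linarith [neg_abs_le (cellsGamma₂ c.cert.base.wL c.cert.cells t), hγabs t]
    · have : ind t = 0 := by rw [hind, Set.indicator_of_notMem ht]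
      have hT' : (c.cert.base.T : ℝ) ≤ |t| := by
        rw [Set.mem_Icc, not_and_or, not_le, not_le] at ht
        rcases ht with ht | ht
        · linarith [neg_abs_le t, le_abs_self t, neg_le_abs t]
        · exact ht.le.trans (le_abs_self t)
      rw [this, mul_zero, add_zero, cellsGamma₂_eq_zeroW hcells hT']
  have hΓlow : -(q * (∑ k ∈ range n, ∑ l ∈ range n, TwistCert.gHat c.cert k l * z k l + 5 * L ^ 2 * (c.cert.nuPrimeAbs : ℝ))) -
      (q - qLo) * C₀ * (7 * N2) ≤ -(1 / (2 * π) * Γ) := by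
    have e : -(1 / (2 * π) * Γ) = -(1 / (2 * π)) * (Γ + C₀ * PiT) + 1 / (2 * π) * (C₀ * PiT) := by ring
    rw [e]
    have h1 : -q * (Γ + C₀ * PiT) ≤ -(1 / (2 * π)) * (Γ + C₀ * PiT) := by nlinarith
    have h2 : qLo * (C₀ * PiT) ≤ 1 / (2 * π) * (C₀ * PiT) :=
      mul_le_mul_of_nonneg_right hqLo1 (mul_nonneg hC₀0 hPiT0)
    have h3 : q * Γ ≤ q * (∑ k ∈ range n, ∑ l ∈ range n, TwistCert.gHat c.cert k l * z k l + 5 * L ^ 2 * (c.cert.nuPrimeAbs : ℝ)) :=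
      mul_le_mul_of_nonneg_left hC hq0
    have hqq : 0 ≤ q - qLo := by linarith [invTwoPiLo20_le_invTwoPiHi20]
    have h4 : (q - qLo) * C₀ * PiT ≤ (q - qLo) * C₀ * (7 * N2) :=
      mul_le_mul_of_nonneg_left hPiTle (mul_nonneg hqq hC₀0)
    nlinarith
  -- the parity bonus in the moments
  set BonInt : ℝ := (∫ w : ℝ, weilConv g (weilReflect g) w *
    (((1 / (2 * Real.cosh (w / 2)) : ℝ) : ℂ))).re with hBonInt
  set ε : ℝ := ((c.epsB : ℚ) : ℝ) with hε
  have ha0q : 0 < c.cert.base.a0 := lt_of_lt_of_le hbpos hba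
  have hBon : ∑ k ∈ range n, ∑ l ∈ range n, bonCoeff c.pc a k l * z k l - 2 * a * ε * N2 ≤ BonInt := by
    have := re_integral_weilConv_weilReflect_sech_ge hg ha0q ha1q (by rwa [← ha_def]) c.pc
      (n := n) (by omega) hnn
    rw [← ha_def] at this
    unfold TwistCertOdd.epsB at hε
    rw [hBonInt, hε, hz, hM, hN2]
    exact this
  have hε0 : 0 ≤ ε := by rw [hε]; exact_mod_cast epsSechQ_nonneg c.pc c.nn ha0q.le
  -- combine B, C and the bonus (no Step A: the form has no polar term)
  have hB' : (c.cert.base.wL : ℝ) * N2 - 1 / (2 * π) * Γ ≤ 1 / (2 * π) * A := by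
    calc (c.cert.base.wL : ℝ) * N2 - 1 / (2 * π) * Γ = 1 / (2 * π) * ((c.cert.base.wL : ℝ) * (2 * π * N2) - Γ) := by
          field_simp
      _ ≤ 1 / (2 * π) * A := mul_le_mul_of_nonneg_left hB hpi.le
  have h5 : ((c.cert.ellLo : ℚ) : ℝ) * N2 ≤ ℓ * N2 := mul_le_mul_of_nonneg_right hℓ hN20
  have step1 : ∑ k ∈ range n, ∑ l ∈ range n,
        (-(q * TwistCert.gHat c.cert k l) + bonCoeff c.pc a k l) * z k l +
      ((c.cert.base.wL : ℝ) + (c.cert.ellLo : ℚ) - 7 * (q - qLo) * C₀) * N2 - 2 * a * ε * N2 -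
      (5 * q * (c.cert.nuPrimeAbs : ℝ)) * L ^ 2 ≤ ℓ * N2 + 1 / (2 * π) * A + BonInt := by
    have e1 : ∑ k ∈ range n, ∑ l ∈ range n, (-(q * TwistCert.gHat c.cert k l) + bonCoeff c.pc a k l) * z k l =
        -(q * ∑ k ∈ range n, ∑ l ∈ range n, TwistCert.gHat c.cert k l * z k l) +
          ∑ k ∈ range n, ∑ l ∈ range n, bonCoeff c.pc a k l * z k l := by
      rw [Finset.mul_sum, ← Finset.sum_neg_distrib, ← Finset.sum_add_distrib]
      refine Finset.sum_congr rfl fun k _ ↦ ?_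
      rw [Finset.mul_sum, ← Finset.sum_neg_distrib, ← Finset.sum_add_distrib]
      refine Finset.sum_congr rfl fun l _ ↦ ?_
      ring
    rw [e1]
    linarith [hB', hΓlow, h5, hBon]
  -- rounding of the matrix and of the (shifted) moment table, together: `|prQ − Pexact| ≤ δ`
  have hMk : ∀ k, ‖M k‖ ≤ L := fun k ↦ norm_weilMoment_le hg ha hsupp' k
  set q6 : ℝ := ((invTwoPiHi : ℚ) : ℝ) with hq6
  have hq60 : 0 ≤ q6 := invTwoPiHi_nonneg
  set δ : ℝ := 1 / 2 ^ c.cert.base.pg + q6 * (1 / 2 ^ c.cert.pnu) with hδ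
  have hδ0 : 0 ≤ δ := by rw [hδ]; positivity
  have hround : ∑ k ∈ range n, ∑ l ∈ range n, ((c.cert.base.prQ nu k l : ℚ) : ℝ) * z k l -
      ∑ k ∈ range n, ∑ l ∈ range n, (-(q * TwistCert.gHat c.cert k l) + bonCoeff c.pc a k l) * z k l ≤
        δ * (n : ℝ) ^ 2 * L ^ 2 := by
    refine WeilCert3.quad_rounding_le' n (fun k l ↦ ((c.cert.base.prQ nu k l : ℚ) : ℝ)) _ δ L hδ0
      (fun k hk l hl ↦ ?_) M hMk
    have h1 : |((c.cert.base.prQ nu k l : ℚ) : ℝ) - ((c.cert.base.pmQ nu k l : ℚ) : ℝ)| ≤ 1 / 2 ^ c.cert.base.pg := by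
      rw [abs_sub_comm]
      unfold WeilCert.prQ
      exact abs_cast_sub_ratRd_le c.cert.base.pg (c.cert.base.pmQ nu k l)
    have h2q := abs_pmQ_sub_pmQexactOdd_le hnuchk (by omega : k < c.cert.base.N + 1) (by omega : l < c.cert.base.N + 1)
    have h2 : |((c.cert.base.pmQ nu k l : ℚ) : ℝ) - ((pmQexactOdd c k l : ℚ) : ℝ)| ≤ q6 * (1 / 2 ^ c.cert.pnu) := by
      have h := (Rat.cast_le (K := ℝ)).2 h2q
      rw [hnu, hq6]
      push_cast at h ⊢
      exact h
    have h3 : ((pmQexactOdd c k l : ℚ) : ℝ) = -(q * TwistCert.gHat c.cert k l) + bonCoeff c.pc a k l := by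
      rw [pmQexactOdd_cast hpceven, hq, ha_def]
    rw [hδ, ← h3]
    exact (abs_sub_le _ _ _).trans (add_le_add h1 h2)
  -- κ_exact
  have hcoef : 0 ≤ 5 * q * (c.cert.nuPrimeAbs : ℝ) + δ * (n : ℝ) ^ 2 :=
    add_nonneg (mul_nonneg (mul_nonneg (by norm_num) hq0) hν0) (by positivity)
  have hkex : ((c.kappaExactOdd : ℚ) : ℝ) =
      ((c.cert.base.wL : ℝ) + (c.cert.ellLo : ℚ) - 7 * (q - qLo) * C₀) -
        2 * a * (5 * q * (c.cert.nuPrimeAbs : ℝ) + δ * (n : ℝ) ^ 2) - 2 * a * ε := by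
    rw [hq, hqLo, hC₀, hn, ha_def, hδ, hq6, hε]
    unfold kappaExactOdd TwistCert.kappaExact TwistCertOdd.epsB
    push_cast
    ring
  have hκle : ((c.kappaQOdd : ℚ) : ℝ) ≤ ((c.kappaExactOdd : ℚ) : ℝ) := by
    unfold kappaQOdd; exact_mod_cast ratRd_le c.cert.base.pg _
  have hκ0 : (0 : ℝ) ≤ ((c.kappaQOdd : ℚ) : ℝ) := by exact_mod_cast hκ
  -- E ≥ Σ pr z + κ N2
  have step3 : ∑ k ∈ range n, ∑ l ∈ range n, ((c.cert.base.prQ nu k l : ℚ) : ℝ) * z k l +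
      ((c.kappaQOdd : ℚ) : ℝ) * N2 ≤ ℓ * N2 + 1 / (2 * π) * A + BonInt := by
    have h1 : ((c.kappaQOdd : ℚ) : ℝ) * N2 ≤ ((c.kappaExactOdd : ℚ) : ℝ) * N2 :=
      mul_le_mul_of_nonneg_right hκle hN20
    rw [hkex] at h1
    have h2 := mul_le_mul_of_nonneg_left hL1 hcoef
    linarith [step1, hround, h1, h2]
  -- Bessel and the algebraic core
  have hbes : 2 * (∑ k ∈ range n, conj (c.cert.base.uVec M k) * M k).re -
      (∑ k ∈ range n, ∑ l ∈ range n, conj (c.cert.base.uVec M k) * c.cert.base.uVec M l * (gramH a k l : ℂ)).re ≤ N2 :=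
    weilNorm2Sq_ge_bessel hg ha hsupp' n (c.cert.base.uVec M)
  have hcore : 0 ≤ (∑ k ∈ range n, ∑ l ∈ range n, ((c.cert.base.prQ nu k l : ℚ) : ℝ) * z k l) +
      ((c.kappaQOdd : ℚ) : ℝ) *
        (2 * (∑ k ∈ range n, conj (c.cert.base.uVec M k) * M k).re -
          (∑ k ∈ range n, ∑ l ∈ range n,
            conj (c.cert.base.uVec M k) * c.cert.base.uVec M l * (gramH a k l : ℂ)).re) := by
    have := WeilCert.core_nonnegK (c := c.cert.base) (nu := nu) (κ := c.kappaQOdd) hN hb0 hb1 a ha_def.symm M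
    rw [← hn] at this
    exact this
  have h4 := mul_le_mul_of_nonneg_left hbes hκ0
  have h6 : 0 ≤ ∑ k ∈ range n, ∑ l ∈ range n, ((c.cert.base.prQ nu k l : ℚ) : ℝ) * z k l +
      ((c.kappaQOdd : ℚ) : ℝ) * N2 := by linarith [h4, hcore]
  have h7 : 0 ≤ ℓ * N2 + 1 / (2 * π) * A + BonInt := by linarith [step3, h6]
  rw [hBonInt, hN2, hA] at h7
  exact h7

/-- **Soundness, monotone form** (cells valid for an even `w ≤ W`). [folklore] -/
theorem form_nonneg_of_check_mono (h : c.checkAlgOdd = true)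
    (hcells : CellsOKW c.cert.base.wL c.cert.base.T c.cert.cells w)
    (heven : ∀ t, w (-t) = w t) (hwW : ∀ t, w t ≤ W t)
    {ℓ : ℝ} (hℓ : ((c.cert.ellLo : ℚ) : ℝ) ≤ ℓ) (hg : IsWeilTest g)
    (hWi : Integrable fun t : ℝ ↦ ‖weilMellin g (1 / 2 + t * I)‖ ^ 2 * W t)
    (hsupp : tsupport g ⊆ Icc (-(c.cert.b : ℝ)) c.cert.b) :
    0 ≤ ℓ * weilNorm2Sq g + 1 / (2 * π) * (∫ t : ℝ, ‖weilMellin g (1 / 2 + t * I)‖ ^ 2 * W t) +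
      (∫ w : ℝ, weilConv g (weilReflect g) w * (((1 / (2 * Real.cosh (w / 2)) : ℝ) : ℂ))).re :=
  form_nonneg_of_check h hcells (fun t ↦ (level_sub_cellsGamma₂_leW hcells heven t).trans (hwW t))
    hℓ hg hWi hsupp

end TwistCertOdd

end Summit.Ventures.WeilGRH

end
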